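import Summits.PneNP.PneNP.Theorems.NegLimitedHalfWindowTribesBiasBlocks
import Mathlib
import HarnessLib

/-!
# Route NegLimited — line `half-window`, stub `stub_tribesBiasResponse` (TB): the tribes bias response
(rung F-N1/p3, ROUND-13; item stmt-PneNP-19888 `NegLimited.NeglimitedHalfLogNegationsR`, registered skeleton
`half-window`; card HOME/pnp-ideate-p3/r13/half-window.md, "Hardest stub")

`stub_tribesBiasResponse : TribesBiasResponse` — for all `w m d` and `0 < p ≤ 1`,

  `expAbsBiasGen (tribesRM3 w m d) p ≤ |1 − 2(1−c)^m| + 2·√((1 − 2c + c²(1+Q)^w)^m − (1−c)^{2m})`,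

`c = 2^{-w}`, `Q = biasSeq p d` (the right-hand side is `tbRHS w m d p` of `NegLimitedHalfWindowDefs`).

THE PROOF (p3's ROUND-13 §2, an EXACT second-moment identity; no Fourier analysis), on top of the bookkeeping of
`NegLimitedHalfWindowTribesBiasBlocks.lean` (re-indexing `expAbsBiasGen_eq_sum_rgwt`, read-once composition
`rgbias_tribesRM3`):
* MOMENTS (`sum_bw_P0`, `sum_bw_P0_sq`): under the block-product weight `∏_b rwt p (σ b)` the block biases are
  independent with `E b = 0` (`rmoment_odd`) and `E b² = biasSeq p d` (`qMoment_eq_biasSeq`), whence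
  `E P₀ = (1−c)^m` and `E P₀² = (1 − 2c + c²(1+Q)^w)^m` EXACTLY;
* `E|1 − 2P₀| ≤ |1 − 2·E P₀| + 2·E|P₀ − E P₀| ≤ |1 − 2(1−c)^m| + 2·√Var P₀` (Cauchy–Schwarz, total weight `1`).

References: R. O'Donnell, *Hardness amplification within NP*, JCSS 69 (2004), Thm 2 / §3 (tribes ∘ recursive
majority; there via noise stability) [ODonnell2004]; cell record HOME/pnp-ideate-p3/ROUND-13.md §2 (the exact identities,
checked with exact rationals on 37 small cases, folder/tb_check.py), r13/BLUEPRINT-R2.md §TB.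

HONEST FRAMING: ONE registered stub (the only genuinely new estimate of the line) of an OPEN rung item; the rung is NOT
closed by this file; FRONTIER rung F-N1 — nothing here bears on P vs NP.
-/

set_option linter.dupNamespace false -- `Summit.PneNP.PneNP.…`: summit = sub-problem name (D-0017 single-conjunct layout)

namespace Summit.PneNP.PneNP.Theorems.NegLimitedHalfWindow

open Finset
open Summit.PneNP.PneNP.Theorems.NegLimitedAmplifiedWindow
  (Restr rwt rbias rmoment qMoment biasSeq sum_rwt rwt_nonneg rmoment_odd qMoment_eq_biasSeq)
open Summit.PneNP.PneNP.Theorems.NegLimitedAmplifiedWindow.Amp (bw bw_nonneg)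

/-! ## The two moments of `P₀` -/

/-- First moment of one tribe input: `Σ_ρ rwt(ρ)·(1 + rbias ρ)/2 = 1/2` (`E b = 0`). -/
theorem sum_rwt_mul_u (p : ℝ) (d : ℕ) :
    ∑ ρ : Restr d, rwt p ρ * ((1 + rbias d ρ) / 2) = 1 / 2 := by
  have h0 := sum_rwt p d
  have h1 : ∑ ρ : Restr d, rwt p ρ * rbias d ρ = 0 := by
    have := rmoment_odd p d 0
    simpa [rmoment] using this
  have : ∑ ρ : Restr d, rwt p ρ * ((1 + rbias d ρ) / 2) =
      (∑ ρ : Restr d, rwt p ρ + ∑ ρ : Restr d, rwt p ρ * rbias d ρ) / 2 := by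
    rw [← Finset.sum_add_distrib, Finset.sum_div]
    exact Finset.sum_congr rfl fun ρ _ => by ring
  rw [this, h0, h1]
  norm_num

/-- Second moment of one tribe input: `Σ_ρ rwt(ρ)·((1 + rbias ρ)/2)² = (1 + biasSeq p d)/4`
(`E b = 0`, `E b² = q_d`). -/
theorem sum_rwt_mul_u_sq (p : ℝ) (d : ℕ) :
    ∑ ρ : Restr d, rwt p ρ * ((1 + rbias d ρ) / 2) ^ 2 = (1 + biasSeq p d) / 4 := by
  have h0 := sum_rwt p d
  have h1 : ∑ ρ : Restr d, rwt p ρ * rbias d ρ = 0 := by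
    have := rmoment_odd p d 0
    simpa [rmoment] using this
  have h2 : ∑ ρ : Restr d, rwt p ρ * rbias d ρ ^ 2 = biasSeq p d := by
    rw [← qMoment_eq_biasSeq]; rfl
  have : ∑ ρ : Restr d, rwt p ρ * ((1 + rbias d ρ) / 2) ^ 2 =
      (∑ ρ : Restr d, rwt p ρ + 2 * ∑ ρ : Restr d, rwt p ρ * rbias d ρ +
        ∑ ρ : Restr d, rwt p ρ * rbias d ρ ^ 2) / 4 := by
    rw [Finset.mul_sum, ← Finset.sum_add_distrib, ← Finset.sum_add_distrib, Finset.sum_div]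
    exact Finset.sum_congr rfl fun ρ _ => by ring
  rw [this, h0, h1, h2]
  ring

/-- **`E P₀ = (1 − 2^{-w})^m`.** -/
theorem sum_bw_P0 (p : ℝ) (w m d : ℕ) :
    ∑ σ : Fin m × Fin w → Restr d, bw (fun _ => rwt p) σ * tribesP0 w m d σ =
      (1 - ((1 : ℝ) / 2) ^ w) ^ m := by
  classical
  have h := sum_bw_tribesStat (rwt p) (sum_rwt p d)
    (fun (_ : Fin m) (_ : Fin w) (ρ : Restr d) => (1 + rbias d ρ) / 2)
  unfold tribesP0
  refine h.trans ?_
  simp only [sum_rwt_mul_u, Finset.prod_const, Finset.card_univ, Fintype.card_fin]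

/-- **`E P₀² = (1 − 2·2^{-w} + (2^{-w})²(1 + Q)^w)^m`**, `Q = biasSeq p d`. -/
theorem sum_bw_P0_sq (p : ℝ) (w m d : ℕ) :
    ∑ σ : Fin m × Fin w → Restr d, bw (fun _ => rwt p) σ * tribesP0 w m d σ ^ 2 =
      (1 - 2 * ((1 : ℝ) / 2) ^ w + (((1 : ℝ) / 2) ^ w) ^ 2 * (1 + biasSeq p d) ^ w) ^ m := by
  classical
  have h := sum_bw_tribesStat_sq (rwt p) (sum_rwt p d)
    (fun (_ : Fin m) (_ : Fin w) (ρ : Restr d) => (1 + rbias d ρ) / 2)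
  unfold tribesP0
  refine h.trans ?_
  simp only [sum_rwt_mul_u, sum_rwt_mul_u_sq, Finset.prod_const, Finset.card_univ, Fintype.card_fin]
  have key : (((1 : ℝ) / 2) ^ w) ^ 2 * (1 + biasSeq p d) ^ w = ((1 + biasSeq p d) / 4) ^ w := by
    rw [← pow_mul, mul_comm w 2, pow_mul, ← mul_pow]
    congr 1
    ring
  rw [key]

/-! ## The stub -/

/-- `E|1 − 2P₀| ≤ |1 − 2E P₀| + 2√(E P₀² − (E P₀)²) = tbRHS` for the block-product restriction weight (Cauchy–Schwarz). -/
theorem sum_bw_abs_le {p : ℝ} (hp0 : 0 ≤ p) (hp1 : p ≤ 1) (w m d : ℕ) :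
    ∑ σ : Fin m × Fin w → Restr d, bw (fun _ => rwt p) σ * |1 - 2 * tribesP0 w m d σ| ≤ tbRHS w m d p := by
  classical
  unfold tbRHS
  set E : ℝ := (1 - ((1 : ℝ) / 2) ^ w) ^ m with hE
  set E2 : ℝ := (1 - 2 * ((1 : ℝ) / 2) ^ w + (((1 : ℝ) / 2) ^ w) ^ 2 * (1 + biasSeq p d) ^ w) ^ m with hE2
  have hbw0 : ∀ σ : Fin m × Fin w → Restr d, 0 ≤ bw (fun _ => rwt p) σ :=
    fun σ => bw_nonneg (fun _ ρ => rwt_nonneg hp0 hp1 ρ) σ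
  have h1 : ∑ σ : Fin m × Fin w → Restr d, bw (fun _ => rwt p) σ = 1 := sum_bw_const_eq_one (sum_rwt p d)
  have hP : ∑ σ : Fin m × Fin w → Restr d, bw (fun _ => rwt p) σ * tribesP0 w m d σ = E := sum_bw_P0 p w m d
  have hP2 : ∑ σ : Fin m × Fin w → Restr d, bw (fun _ => rwt p) σ * tribesP0 w m d σ ^ 2 = E2 :=
    sum_bw_P0_sq p w m d
  -- pointwise triangle inequality
  have hpt : ∀ σ : Fin m × Fin w → Restr d, bw (fun _ => rwt p) σ * |1 - 2 * tribesP0 w m d σ| ≤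
      bw (fun _ => rwt p) σ * |1 - 2 * E| + 2 * (bw (fun _ => rwt p) σ * |tribesP0 w m d σ - E|) := by
    intro σ
    have htri : |1 - 2 * tribesP0 w m d σ| ≤ |1 - 2 * E| + 2 * |tribesP0 w m d σ - E| := by
      have h := abs_sub (1 - 2 * E) (2 * (tribesP0 w m d σ - E))
      have h2 : |2 * (tribesP0 w m d σ - E)| = 2 * |tribesP0 w m d σ - E| := by
        rw [abs_mul, abs_of_pos (by norm_num : (0 : ℝ) < 2)]
      have h3 : 1 - 2 * E - 2 * (tribesP0 w m d σ - E) = 1 - 2 * tribesP0 w m d σ := by ring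
      rw [h3, h2] at h
      exact h
    nlinarith [hbw0 σ, abs_nonneg (1 - 2 * E), abs_nonneg (tribesP0 w m d σ - E)]
  refine (Finset.sum_le_sum fun σ _ => hpt σ).trans ?_
  rw [Finset.sum_add_distrib, ← Finset.sum_mul, h1, one_mul, ← Finset.mul_sum]
  -- Cauchy–Schwarz for the deviation term
  have hCS : (∑ σ : Fin m × Fin w → Restr d, bw (fun _ => rwt p) σ * |tribesP0 w m d σ - E|) ^ 2 ≤
      (∑ σ : Fin m × Fin w → Restr d, bw (fun _ => rwt p) σ) *
        ∑ σ : Fin m × Fin w → Restr d, bw (fun _ => rwt p) σ * (tribesP0 w m d σ - E) ^ 2 := by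
    refine sum_sq_le_sum_mul_sum_of_sq_le_mul univ (fun σ _ => hbw0 σ)
      (fun σ _ => mul_nonneg (hbw0 σ) (sq_nonneg _)) fun σ _ => le_of_eq ?_
    rw [mul_pow, sq_abs]
    ring
  rw [h1, one_mul] at hCS
  have hvar : ∑ σ : Fin m × Fin w → Restr d, bw (fun _ => rwt p) σ * (tribesP0 w m d σ - E) ^ 2 =
      E2 - E ^ 2 := by
    have hexp : ∀ σ : Fin m × Fin w → Restr d, bw (fun _ => rwt p) σ * (tribesP0 w m d σ - E) ^ 2 =
        bw (fun _ => rwt p) σ * tribesP0 w m d σ ^ 2 - 2 * E * (bw (fun _ => rwt p) σ * tribesP0 w m d σ) +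
          E ^ 2 * bw (fun _ => rwt p) σ := fun σ => by ring
    rw [Finset.sum_congr rfl fun σ _ => hexp σ, Finset.sum_add_distrib, Finset.sum_sub_distrib,
      ← Finset.mul_sum, ← Finset.mul_sum, hP2, hP, h1]
    ring
  rw [hvar] at hCS
  have hdev : ∑ σ : Fin m × Fin w → Restr d, bw (fun _ => rwt p) σ * |tribesP0 w m d σ - E| ≤
      Real.sqrt (E2 - E ^ 2) := (le_abs_self _).trans (Real.abs_le_sqrt hCS)
  have hpow : E ^ 2 = (1 - ((1 : ℝ) / 2) ^ w) ^ (2 * m) := by rw [hE, ← pow_mul, mul_comm]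
  rw [hpow] at hdev
  linarith

/-- **Registered stub `stub_tribesBiasResponse`** of the skeleton `half-window` (stmt-PneNP-19888): the tribes bias
response `E_ρ |bias(TRIBES_{w,m} ∘ RM3_d ↾ ρ)| ≤ |1 − 2(1−2^{-w})^m| + 2·√Var`, BY NAME. -/
theorem stub_tribesBiasResponse : TribesBiasResponse := by
  intro w m d p hp hp1
  classical
  rw [expAbsBiasGen_eq_sum_rgwt]
  -- restrictions of `(Fin m × Fin w) × (Fin d → Fin 3)` as block families `σ`
  rw [← Fintype.sum_equiv (Equiv.curry (Fin m × Fin w) (Fin d → Fin 3) (Option Bool)).symm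
    (fun σ : Fin m × Fin w → Restr d => bw (fun _ => rwt p) σ * |1 - 2 * tribesP0 w m d σ|) _
    (fun σ => by
      show bw (fun _ => rwt p) σ * |1 - 2 * tribesP0 w m d σ| =
        rgwt p (Function.uncurry σ) * |rgbias (tribesRM3 w m d) (Function.uncurry σ)|
      rw [rgwt_uncurry, rgbias_tribesRM3])]
  exact sum_bw_abs_le hp.le hp1 w m d

end Summit.PneNP.PneNP.Theorems.NegLimitedHalfWindow
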